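import Literature.Analysis.FluidPDE.SereginSverak2002FinalEnergy
import HarnessLib

/-!
# Named fact (corrected statement, discharged): Seregin–Šverák 2002, Thm. 2.2, with its final-time hypothesis

Literature file accompanying the named fact `Literature.Analysis.FluidPDE.seregin_sverak_2002`
(`SereginSverakPressure.lean`), written after the primary text was read:

G. Seregin, V. Šverák, *Navier–Stokes equations with lower bounds on the pressure*,
Arch. Ration. Mech. Anal. **163** (2002) 65–86 [SereginSverak2002] (author-hosted offprint of
the journal version).

## The printed theorem and the discrepancy

**Theorem 2.2 (p. 70), verbatim structure.** "Let `v` be a Leray–Hopf solution to the Cauchy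
problem (2.1)–(2.3) [on `ℝ³ × ]0, +∞[`] and let `p` be the normalized pressure associated with
`v` [(2.6): `p = (4π)⁻¹ ∫ |x-y|⁻¹ div div (v ⊗ v)(y) dy`]. Assume that there exists a function `g`
satisfying condition (C) such that `|v(x,t)|² + 2p(x,t) ≤ g(x,t)`, `x ∈ ℝ³`, `t ∈ ]0,+∞[` (2.9),
or `p(x,t) ≥ -g(x,t)`, `x ∈ ℝ³`, `t ∈ ]0,+∞[` (2.10). Then `v` is Hölder continuous on
`ℝ³ × ]0,∞[` and therefore smooth and unique." Condition (C) (Def. 2.1, p. 70): for any `t₀ > 0`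
there is `R₀(t₀) > 0` with (2.7) `A(t₀) ≡ sup_{x₀ ∈ ℝ³} sup_{t₀ - R₀² ≤ t ≤ t₀} ∫_{B(x₀,R₀)} g(x,t)
|x-x₀|⁻¹ dx < +∞` and (2.8) for each `x₀` and `R ∈ ]0, R₀]`, `t ↦ ∫_{B(x₀,R)} g(x,t)|x-x₀|⁻¹ dx`
is continuous at `t₀` FROM THE LEFT; Remark 2.3: constants `g ≡ K > 0` satisfy (C).

**The discrepancy.** The hypothesis is imposed at EVERY `t > 0` for a GLOBAL weak solution, in
particular at the putative first singular time `t₀`, and the proof (§4) uses it there: in case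
(2.9) the bound (4.8) and the identity (4.9) are evaluated at `t = t₀` (pp. 80–81, "This is one of
the crucial points of our argument"); a radius `R⋆` with
`(1/2)∫_{B(x₀,R⋆)} g/ρ + ∫_{B(x₀,R⋆)} |ṽ(t₀)|²/ρ + ∫_{B(x₀,R⋆)} [g - |v|² - 2p](t₀)/ρ < ε⋆/2`
(`ρ = |x - x₀|`, `ṽ` the radial part; three nonnegative integrands AT `t₀`) is chosen, whence by
(4.8) at `t₀` the scaled energy of the final-time field is small at all scales `R ≤ R⋆`,
`(2R)⁻¹ ∫_{B(x₀,R)} |v(x,t₀)|² dx < ε⋆/2`; only then the left continuity at `t₀` of the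
pressure-free form (4.9) (from (2.8) and the strong `L²` continuity (4.10)) carries the smallness to
`t < t₀`, where Lemma 3.3 (the `A`-criterion) applies; case (2.10) is identical with (4.11)–(4.13)
at `t₀` (pp. 83–84). The tree's fact `seregin_sverak_2002` (transcribed, before the text was
available, from secondary paraphrases) imposes the one-sided bound only for `t ∈ (0, T)`, `T` the
final time of a solution known classically on `[0, T)` — i.e. it DROPS the hypothesis at the
singular time and is therefore a strengthening that the source does not prove. (Its pressure-floor
half is nevertheless a theorem of the tree, `seregin_sverak_2002_of_floor`, by an argument that
avoids the final time; its head-ceiling half on `(0, T)` alone is not covered by the source.)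

**The corrected statement vendored here** keeps the tree's classes and the bound on `(0, T)` and
adds the final-time input in the explicit form in which the printed `t₀`-step delivers and uses
it — no scaled energy concentration of the final value:

  `(FE)  r⁻¹ ∫_{B(x₀,r)} ‖u(T,x)‖² dx → 0` as `r → 0⁺`, for every `x₀`

(scale invariant; implied by `∫_{B(x₀,1)} ‖u(T)‖² ‖x - x₀‖⁻¹ dx < ∞`, the form of the prequel
`seregin_sverak_2002_of_finalMoment`; automatic at regular points). Under (FE) and either one-sided
bound on `(0, T) × ℝ³` the printed conclusion holds and is PROVED in the tree
(`seregin_sverak_2002_of_finalScaledEnergy`, `SereginSverak2002FinalEnergy.lean`), so the fact below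
is discharged (`seregin_sverak_2002_withFinalEnergy_holds`). The original fact implies the corrected
one (`seregin_sverak_2002_withFinalEnergy.of_seregin_sverak_2002`), not conversely. The
pressure-floor alternative alone, WITHOUT any final-time hypothesis, is the tree theorem
`seregin_sverak_2002_of_floor` (`SereginSverak2002CaseB.lean`); the final-moment form is
`seregin_sverak_2002_of_finalMoment` (`SereginSverak2002FinalMoment.lean`).

## References

* G. Seregin, V. Šverák, Arch. Ration. Mech. Anal. 163 (2002) 65–86: Def. 2.1, Thm. 2.2, Remark 2.3
  (p. 70); Lemma 3.2, Lemma 3.3 (pp. 72–76); §4 (4.1), (4.7)–(4.13) (pp. 76–84). [SereginSverak2002]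
* J. C. Robinson, J. L. Rodrigo, W. Sadowski, CUP 2016, Thm. 8.17 (continuation of bounded
  solutions; the tree's `hasSmoothExtensionPast_of_bounded_holds`). [RobinsonRodrigoSadowski2016]
-/

noncomputable section

open MeasureTheory Set Metric Filter Topology

namespace Literature.Analysis.FluidPDE

/-- NAMED FACT, corrected form of `seregin_sverak_2002` (**Seregin–Šverák 2002, Thm. 2.2 with
`g ≡ K`, final-time hypothesis explicit**). Let `ν > 0`, `T > 0`, `(u, p)` a classical solution
of the unforced Navier–Stokes system on `ℝ³ × [0, T)` which is Leray–Hopf on `[0, T]` from its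
rapidly decaying datum `u 0`. Assume EITHER `|u(t,x)|²/2 + p̃[u(t)](x) ≤ K` on `(0, T) × ℝ³` OR
`p̃[u(t)](x) ≥ -K` there (`p̃` the normalised pressure), AND that the final value `u(T)` (the
weak `L²` trace) has no scaled energy concentration, `r⁻¹ ∫_{B(x₀,r)} ‖u(T,x)‖² dx → 0` as
`r → 0⁺` at every `x₀` — what the printed proof obtains from its hypothesis at the singular time
((4.8) at `t₀`, pp. 80–81; (4.13), p. 84; the printed hypothesis is the one-sided bound at every
`t > 0`, in particular at `t₀`). Then `u` is bounded on `(δ, T) × ℝ³` for every `δ ∈ (0, T)`.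
Discharged: `seregin_sverak_2002_withFinalEnergy_holds`.
[cite: SereginSverak2002, Thm. 2.2 (p. 70); proof §4, (4.8)–(4.9) and (4.13) at t₀ (pp. 80–84)] -/
def seregin_sverak_2002_withFinalEnergy : Prop :=
  ∀ (ν T : ℝ), 0 < ν → 0 < T →
    ∀ (u : ℝ → EuclideanSpace ℝ (Fin 3) → EuclideanSpace ℝ (Fin 3))
      (p : ℝ → EuclideanSpace ℝ (Fin 3) → ℝ),
      IsClassicalNSSolutionOn (Ico 0 T) ν 0 u p → IsLerayHopfOn T ν 0 (u 0) u →
        HasRapidSpatialDecay (u 0) →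
          ((∃ K : ℝ, ∀ t ∈ Ioo 0 T, ∀ x, ‖u t x‖ ^ 2 / 2 + normalisedPressure (u t) x ≤ K) ∨
            (∃ K : ℝ, ∀ t ∈ Ioo 0 T, ∀ x, -K ≤ normalisedPressure (u t) x)) →
          (∀ x₀ : EuclideanSpace ℝ (Fin 3),
            Tendsto (fun r : ℝ => r⁻¹ * ∫ x in ball x₀ r, ‖u T x‖ ^ 2) (𝓝[>] 0) (𝓝 0)) →
          ∀ δ ∈ Ioo 0 T, ∃ M : ℝ, ∀ t ∈ Ioo δ T, ∀ x, ‖u t x‖ ≤ M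

/-- **Discharge** of `seregin_sverak_2002_withFinalEnergy` (by `seregin_sverak_2002_of_finalScaledEnergy`).
[cite: SereginSverak2002, Thm. 2.2 (p. 70)] -/
theorem seregin_sverak_2002_withFinalEnergy_holds : seregin_sverak_2002_withFinalEnergy :=
  seregin_sverak_2002_of_finalScaledEnergy

/-- The original (stronger) fact implies the corrected one. [cite: SereginSverak2002, Thm. 2.2 (p. 70)] -/
theorem seregin_sverak_2002_withFinalEnergy.of_seregin_sverak_2002 (h : seregin_sverak_2002) :
    seregin_sverak_2002_withFinalEnergy :=
  fun ν T hν hT u p hsol hLH hd hone _ => h ν T hν hT u p hsol hLH hd hone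

/-- **Continuation form.** Under either one-sided bound on `(0, T) × ℝ³` and (FE), a classical
Leray–Hopf solution from a rapidly decaying datum extends as a classical solution past `T`
(restart at an energy-good time `s`, `IsLerayHopfOn.exists_isLerayHopfOn_translate`; the
translate is bounded on `[0, T - s) × ℝ³` by the fact; continue by
`hasSmoothExtensionPast_of_bounded_holds`, RRS 2016 Thm. 8.17; glue with
`HasSmoothExtensionPast.of_translate` — the pattern of `seregin_sverak_2002.hasSmoothExtensionPast`).
[cite: SereginSverak2002, Thm. 2.2 (p. 70)] -/
theorem seregin_sverak_2002_withFinalEnergy.hasSmoothExtensionPast {ν T : ℝ} (hν : 0 < ν)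
    (hT : 0 < T) {u : ℝ → EuclideanSpace ℝ (Fin 3) → EuclideanSpace ℝ (Fin 3)}
    {p : ℝ → EuclideanSpace ℝ (Fin 3) → ℝ}
    (hsol : IsClassicalNSSolutionOn (Ico 0 T) ν 0 u p) (hLH : IsLerayHopfOn T ν 0 (u 0) u)
    (h₀ : HasRapidSpatialDecay (u 0))
    (hone : (∃ K : ℝ, ∀ t ∈ Ioo 0 T, ∀ x, ‖u t x‖ ^ 2 / 2 + normalisedPressure (u t) x ≤ K) ∨
      (∃ K : ℝ, ∀ t ∈ Ioo 0 T, ∀ x, -K ≤ normalisedPressure (u t) x))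
    (hFE : ∀ x₀ : EuclideanSpace ℝ (Fin 3),
      Tendsto (fun r : ℝ => r⁻¹ * ∫ x in ball x₀ r, ‖u T x‖ ^ 2) (𝓝[>] 0) (𝓝 0)) :
    HasSmoothExtensionPast ν 0 u T := by
  have hbd : ∀ δ ∈ Ioo 0 T, ∃ M : ℝ, ∀ t ∈ Ioo δ T, ∀ x, ‖u t x‖ ≤ M :=
    seregin_sverak_2002_withFinalEnergy_holds ν T hν hT u p hsol hLH h₀ hone hFE
  -- an energy-good restarting time `s ∈ (0, T)`
  obtain ⟨s, hs, hLHs⟩ := hLH.exists_isLerayHopfOn_translate hsol hν.le hT le_rfl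
  have hs2 : s / 2 ∈ Ioo 0 T := ⟨by linarith [hs.1], by linarith [hs.2]⟩
  obtain ⟨M, hM⟩ := hbd (s / 2) hs2
  -- the translate: classical on `[0, T - s)`, Leray–Hopf from `u s`, bounded on `[0, T - s) × ℝ³`
  have hsol' : IsClassicalNSSolutionOn (Ico 0 (T - s)) ν 0 (fun t => u (t + s))
      (fun t => p (t + s)) := hsol.translate_Ico_zero hs.1.le
  have hLHs' : IsLerayHopfOn (T - s) ν 0 ((fun t => u (t + s)) 0) (fun t => u (t + s)) := by
    show IsLerayHopfOn (T - s) ν 0 (u (0 + s)) (fun t => u (t + s))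
    rw [zero_add]
    exact hLHs
  have hMs : ∃ M : ℝ, ∀ t ∈ Ico 0 (T - s), ∀ x, ‖(fun t => u (t + s)) t x‖ ≤ M :=
    ⟨M, fun t ht x => hM (t + s) ⟨by linarith [ht.1, hs.1], by linarith [ht.2]⟩ x⟩
  have hext : HasSmoothExtensionPast ν 0 (fun t => u (t + s)) (T - s) :=
    hasSmoothExtensionPast_of_bounded_holds hν (sub_pos.2 hs.2) hsol' hLHs' hMs
  exact HasSmoothExtensionPast.of_translate hsol hs.1 hs.2 hext

/-- **The head-pressure alternative with (FE), in the shape of the route decl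
`OneSidedHeadRegularity`** (head bound on `[0, T) × ℝ³`, conclusion `HasSmoothExtensionPast`),
carrying the additional final-time hypothesis that the printed theorem requires.
[cite: SereginSverak2002, Thm. 2.2 (p. 70), case (2.9)] -/
theorem seregin_sverak_2002_withFinalEnergy.of_head_le :
    ∀ (ν T : ℝ), 0 < ν → 0 < T →
      ∀ (u : ℝ → EuclideanSpace ℝ (Fin 3) → EuclideanSpace ℝ (Fin 3))
        (p : ℝ → EuclideanSpace ℝ (Fin 3) → ℝ),
        IsClassicalNSSolutionOn (Ico 0 T) ν 0 u p → IsLerayHopfOn T ν 0 (u 0) u →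
          HasRapidSpatialDecay (u 0) →
            (∃ K : ℝ, ∀ t ∈ Ico 0 T, ∀ x, ‖u t x‖ ^ 2 / 2 + normalisedPressure (u t) x ≤ K) →
            (∀ x₀ : EuclideanSpace ℝ (Fin 3),
              Tendsto (fun r : ℝ => r⁻¹ * ∫ x in ball x₀ r, ‖u T x‖ ^ 2) (𝓝[>] 0) (𝓝 0)) →
              HasSmoothExtensionPast ν 0 u T := by
  intro ν T hν hT u p hsol hLH h₀ hK hFE
  obtain ⟨K, hK⟩ := hK
  exact seregin_sverak_2002_withFinalEnergy.hasSmoothExtensionPast hν hT hsol hLH h₀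
    (Or.inl ⟨K, fun t ht x => hK t (Ioo_subset_Ico_self ht) x⟩) hFE

end Literature.Analysis.FluidPDE

end
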